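/- Copyright: the b2b-balaban cell (near-miss cell 7), T⁴-continuum fan-out; row NE7b ROUND-2 swarm, seat
t4-ne7b-formalise-leaf-01 (gen 9) (road W-RP, offer «W-2T» file 4 «THE COLLAPSE» — over W7 `HistoryChessboardGibbs` p227659 ∕
v1.1 p227970 and W-2T file 1; journal INTENT l.17954).  Released under the licence of the surrounding project. -/
import Summits.QuantumFields.BalabanUV.T4Continuum.Support.HistoryChessboardGibbsCells

/-!
# Road W-RP: THE TWO-TERM EVENT MODEL, file 4 — EVERY W7 witness COLLAPSES to a two-term W7 witness

Summits-side support leaf of the T⁴-continuum cell (rung (B)+1 on a FINITE torus only; NOT infinite volume, NOT the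
mass gap, NOT the Clay statement; NOT a proof of the spine estimate NE7b).  Row NE7b, road **W-RP**, offer «W-2T», file 4:
a THEOREM about W7's witness shape (`HistoryChessboardGibbs.ChessboardGibbsWitness`, leaf-03 g5), using file 1's aggregate
sandwich.  [folklore] measure bookkeeping (finite additivity of set integrals) over the cell's OWN carriers; ONE `def`
(`ChessboardGibbsWitness.collapse`, a structure VALUE) and its DATA abbreviations; no hypothesis shape, nothing printed
asserted, no `[cite:]` tag, no `Prop`-valued FACT minted (c1), no constant (c2∕c6), no exit ∕ socket ∕ `HistoryConstants`
file touched (c3).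

WHAT.  For ANY `X : ChessboardGibbsWitness D g₀ os ι Λ m₁` (any term index type `ι`, any number of terms, any shells),
**`X.collapse hM : ChessboardGibbsWitness D g₀ os Bool Λ m₁`** — the SAME cell events, patterns, rates, source radius, volume
factor and threshold, with TWO terms per cutoff: `true` ↦ the union of the bad terms' events, `false` ↦ the union of the
good terms' events; weights, shells and cores are the SUMS over the two classes; NE7c's shell bound is the sum of X's;
NE7's budget is file 1's AGGREGATE sandwich of X's per-term budget (`sandwich_of_reindexedBudget`: constant `c₀ + ν`,
radius `vol·((rr+u)+(s+s₂))`, rates folded into `rr`); `repr` by FINITE ADDITIVITY of the event integrals over X's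
partition (`integral_biUnion_finset`, `collapseSide`).  Hence (§5 `forSmallCouplings_gibbsWitness_iff_bool`, `continuumYM4Torus_of_boolGibbsWitness_fsc`) the W7
headline's witness hypothesis with ARBITRARY term types is equivalent to the one with `ι := Bool`: **on road W the term layer of the display is eliminable — a theorem,
not a modelling choice.**  (File 2's `CellRoadWitness` fixes, in addition, the bad event to be the union of ALL cell
events; `collapse` keeps X's own bad union, which is only CONTAINED in it.)

HONEST.  Bookkeeping about a hypothesis SHAPE; discharges nothing analytic ((U1)+(G2) `univ_le`, NE7's sandwich, which
cell events); NOTHING of the nine; spine count 0∕9 UNCHANGED; NE7b NOT proved; finite T⁴ only.  HONEST DEPENDENCY (cell):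
continuum YM on T⁴ ⇐ BetaPertH ∧ nine spine estimates (0/9 proved); BetaPertH ⇐ (D1) ∧ (D4) ∧ CAP+tail; G-an2-4 gates
asym, D1 and NE2/3/4.  This file changes none of it. -/

open Finset MeasureTheory
open Literature.Barriers.CriticalPhenomena.NonGibbs
open Literature.MathematicalPhysics.QuantumFieldTheory.Balaban1983to89
open Literature.MathematicalPhysics.QuantumFieldTheory.Balaban1983to89.Missing
open Literature.MathematicalPhysics.QuantumFieldTheory.Balaban1983to89.T4Continuum
open Literature.MathematicalPhysics.QuantumFieldTheory.Balaban1983to89.T4IndicatorShell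
open Literature.MathematicalPhysics.QuantumFieldTheory.Balaban1983to89.T4MatchingAssembly
open Literature.MathematicalPhysics.QuantumFieldTheory.Balaban1983to89.T4MatchingClosure
open Summit.QuantumFields.BalabanUV.T4Continuum
open HistoryRPTowerLaw HistoryChessboardEventsCubes HistoryChessboardTowerRepr HistoryChessboardApex
open HistoryChessboardHeadline HistoryChessboardGibbsSide HistoryChessboardGibbs HistoryChessboardGibbsCells

namespace Summit.QuantumFields.BalabanUV.T4Continuum.HistoryChessboardGibbsCollapse

noncomputable section

/-! ## §1 Two classes of a term family; unions of events; sums of weights -/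

section Classes

variable {ι : Type*} [DecidableEq ι]

/-- **THE TWO CLASSES OF A TERM FAMILY**: `true` ↦ the bad terms (`T ∩ Bad`), `false` ↦ the good terms (`T \ Bad`). -/
def cls (T Bad : Finset ι) : Bool → Finset ι
  | true => T ∩ Bad
  | false => T \ Bad

/-- the two classes are inside the family. [folklore] -/
theorem cls_subset (T Bad : Finset ι) : ∀ b, cls T Bad b ⊆ T
  | true => Finset.inter_subset_left
  | false => Finset.sdiff_subset

/-- the two classes are disjoint. [folklore] -/
theorem disjoint_cls (T Bad : Finset ι) : Disjoint (cls T Bad true) (cls T Bad false) := by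
  show Disjoint (T ∩ Bad) (T \ Bad)
  exact Finset.disjoint_left.2 fun τ h1 h2 => (Finset.mem_sdiff.1 h2).2 (Finset.mem_inter.1 h1).2

/-- the two classes cover the family: a sum over `T` is the sum of the two class sums. [folklore] -/
theorem sum_cls (T Bad : Finset ι) (f : ι → ℝ) :
    ∑ b : Bool, ∑ τ ∈ cls T Bad b, f τ = ∑ τ ∈ T, f τ := by
  rw [Fintype.sum_bool, ← Finset.sum_union (disjoint_cls T Bad)]
  congr 1
  ext τ
  simp only [cls, Finset.mem_union, Finset.mem_inter, Finset.mem_sdiff]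
  tauto

variable {Ω : Type*}

/-- **THE CLASS EVENTS**: the union of the events of a class. -/
def clsEv (T Bad : Finset ι) (ev : ι → Set Ω) (b : Bool) : Set Ω := ⋃ τ ∈ cls T Bad b, ev τ

/-- **THE CLASS SUMS** of a weight family. -/
def clsSum (T Bad : Finset ι) (A : ℝ → ι → ℝ) (t : ℝ) (b : Bool) : ℝ := ∑ τ ∈ cls T Bad b, A t τ

end Classes

/-! ## §2 The two-class side of a W7 side -/

section Side

variable {F : T4Family} {G : Type*} [GaugeGroup G] [MeasurableSpace G] [HaarData G] [RegularGaugeGroup G]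
  {ι Λ : Type*} [DecidableEq ι] {D : FiniteEpsData F G} {g₀ : ℕ → ℝ} {os : List (ULoop F)} {m₁ : ℕ} {hm₁ : m₁ ≤ F.m}
  {K : ℕ} {P : Finset Λ} {T : Finset ι} {A : ℝ → ι → ℝ} {Bad : Finset ι} {ev : ι → Set (Tower (F.P K) G K)}
  {E : Λ → BlockIdx 4 (cubeCount F m₁) → Set (Tower (F.P K) G K)} {r : ℝ}

/-- the dressing `e^{t·obsTower}` is integrable on every event under the (probability) Gibbs tower. [folklore] -/
theorem integrableOn_exp_obsTower (hM : D.AvgMeasurable) (t : ℝ) (S : Set (Tower (F.P K) G K)) :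
    IntegrableOn (fun ω => Real.exp (t * obsTower K os ω)) S (gibbsTower D g₀ K) := by
  haveI := isProbabilityMeasure_gibbsTower D hM g₀ K
  exact (T4GenFunBounds.integrable_exp_mul_of_bound (measurable_obsTower K os).aemeasurable
    (Filter.Eventually.of_forall (abs_obsTower_le_one K os)) t).integrableOn

/-- **THE TWO-CLASS SIDE**: a W7 side with terms `T`, bad class `Bad`, events `ev` gives the W7 side with the two terms
`univ : Finset Bool`, events `clsEv T Bad ev`, weights `clsSum T Bad A`, bad class `{true}`: `repr` by finite additivity
over X's disjoint measurable events, `ev_cover` ∕ `ev_disj` ∕ `bad_sub` from X's, the cell clauses verbatim. [folklore] -/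
theorem collapseSide (hM : D.AvgMeasurable) (H : GibbsCubeSide D g₀ os hm₁ K P T A Bad ev E r) :
    GibbsCubeSide D g₀ os hm₁ K P (Finset.univ : Finset Bool) (clsSum T Bad A) {true} (clsEv T Bad ev) E r where
  bad_subset := Finset.subset_univ _
  ev_meas b _ := Finset.measurableSet_biUnion _ fun τ hτ => H.ev_meas τ (cls_subset T Bad b hτ)
  E_meas := H.E_meas
  repr t b _ := by
    show ∑ τ ∈ cls T Bad b, A t τ = Zrun D K (g₀ K) * ∫ ω in ⋃ τ ∈ cls T Bad b, ev τ, _ ∂gibbsTower D g₀ K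
    rw [integral_biUnion_finset (cls T Bad b) (fun τ hτ => H.ev_meas τ (cls_subset T Bad b hτ))
      (H.ev_disj.subset (Finset.coe_subset.2 (cls_subset T Bad b)))
      (fun τ _ => integrableOn_exp_obsTower hM t _), Finset.mul_sum]
    exact Finset.sum_congr rfl fun τ hτ => H.repr t τ (cls_subset T Bad b hτ)
  ev_cover ω hω := by
    obtain ⟨τ, hτ, hω⟩ := Set.mem_iUnion₂.1 (H.ev_cover hω)
    by_cases hb : τ ∈ Bad
    · exact Set.mem_iUnion₂.2 ⟨true, Finset.mem_univ _, Set.mem_iUnion₂.2 ⟨τ, Finset.mem_inter.2 ⟨hτ, hb⟩, hω⟩⟩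
    · exact Set.mem_iUnion₂.2 ⟨false, Finset.mem_univ _, Set.mem_iUnion₂.2 ⟨τ, Finset.mem_sdiff.2 ⟨hτ, hb⟩, hω⟩⟩
  ev_disj a _ b _ hab := by
    have key : ∀ {a b : Bool}, a ≠ b → Disjoint (clsEv T Bad ev a) (clsEv T Bad ev b) := by
      intro a b hab
      refine Set.disjoint_iUnion₂_left.2 fun τ hτ => Set.disjoint_iUnion₂_right.2 fun σ hσ => ?_
      refine H.ev_disj (cls_subset T Bad a hτ) (cls_subset T Bad b hσ) fun h => ?_
      subst h
      cases a <;> cases b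
      · exact hab rfl
      · exact Finset.disjoint_left.1 (disjoint_cls T Bad) hσ hτ
      · exact Finset.disjoint_left.1 (disjoint_cls T Bad) hτ hσ
      · exact hab rfl
    exact key hab
  bad_sub b hb := by
    rw [Finset.mem_singleton] at hb
    subst hb
    exact Set.iUnion₂_subset fun τ hτ => H.bad_sub τ (Finset.mem_inter.1 hτ).2
  loc := H.loc
  sym := H.sym
  univ_le := H.univ_le
  r_nonneg := H.r_nonneg

end Side

/-! ## §3 Shells and the budget of the two classes -/

section Budget

variable {ι : Type*} [DecidableEq ι] {l₀ vol : ℝ} {T : ℕ → Finset ι} {A B shA shB : ℕ → ℝ → ι → ℝ} {Wsh : ℕ → ℝ}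
  {Bad : ℕ → Finset ι} {Cc Rr CcRec RrRec : ℕ → ℝ → ι → ℝ} {ν u s₂ c₀ rr s : ℕ → ℝ}

/-- **NE7c FOR THE TWO CLASSES**: the class sums of the shells obey `ShellWeightBound` with the same `Wsh` (sums of the
termwise clauses; the totals over `univ : Finset Bool` are the totals over `T K`). [folklore] -/
theorem shellWeightBound_cls (h : ShellWeightBound l₀ T A B shA shB Wsh) :
    ShellWeightBound l₀ (fun _ => (Finset.univ : Finset Bool)) (fun K => clsSum (T K) (Bad K) (A K))
      (fun K => clsSum (T K) (Bad K) (B K)) (fun K => clsSum (T K) (Bad K) (shA K)) (fun K => clsSum (T K) (Bad K) (shB K))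
      Wsh where
  nonneg := h.nonneg
  summable := h.summable
  sh_nonneg_left K t ht b _ := Finset.sum_nonneg fun τ hτ => h.sh_nonneg_left K t ht τ (cls_subset _ _ b hτ)
  sh_le_left K t ht b _ := Finset.sum_le_sum fun τ hτ => h.sh_le_left K t ht τ (cls_subset _ _ b hτ)
  sh_nonneg_right K t ht b _ := Finset.sum_nonneg fun τ hτ => h.sh_nonneg_right K t ht τ (cls_subset _ _ b hτ)
  sh_le_right K t ht b _ := Finset.sum_le_sum fun τ hτ => h.sh_le_right K t ht τ (cls_subset _ _ b hτ)
  left K t ht := by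
    show ∑ b : Bool, clsSum (T K) (Bad K) (shA K) t b ≤ Wsh K * ∑ b : Bool, clsSum (T K) (Bad K) (A K) t b
    simp only [clsSum, sum_cls]
    exact h.left K t ht
  right K t ht := by
    show ∑ b : Bool, clsSum (T K) (Bad K) (shB K) t b ≤ Wsh K * ∑ b : Bool, clsSum (T K) (Bad K) (B K) t b
    simp only [clsSum, sum_cls]
    exact h.right K t ht

/-- the good class of `univ ∖ {true}` is `false`. [folklore] -/
theorem eq_false_of_mem_sdiff {b : Bool} (hb : b ∈ (Finset.univ : Finset Bool) \ {true}) : b = false := by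
  cases b
  · rfl
  · simp at hb

/-- the core of the good class is the sum of the termwise cores over the good terms. [folklore] -/
theorem clsSum_false_sub (T Bad : Finset ι) (A shA : ℝ → ι → ℝ) (t : ℝ) :
    clsSum T Bad A t false - clsSum T Bad shA t false = ∑ τ ∈ T \ Bad, (A t τ - shA t τ) := by
  show ∑ τ ∈ T \ Bad, A t τ - ∑ τ ∈ T \ Bad, shA t τ = _
  rw [Finset.sum_sub_distrib]

/-- **NE7 FOR THE TWO CLASSES**: the per-term budget on the cores gives the budget for the two-class families on their
cores — one good term per cutoff, the constants of file 1's `sandwich_of_reindexedBudget` (`c₀ + ν`, radius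
`vol·((rr+u)+(s+s₂))`, rates `ν, 0, 0, c₀, (rr+u)+(s+s₂), 0`). [folklore] -/
theorem reindexedBudget_cls
    (h : ReindexedBudget l₀ vol T (fun K t τ => A K t τ - shA K t τ) (fun K t τ => B K t τ - shB K t τ)
      (fun K _ => Bad K) Cc Rr CcRec RrRec ν u s₂ c₀ rr s) :
    ReindexedBudget l₀ vol (fun _ => (Finset.univ : Finset Bool))
      (fun K t b => clsSum (T K) (Bad K) (A K) t b - clsSum (T K) (Bad K) (shA K) t b)
      (fun K t b => clsSum (T K) (Bad K) (B K) t b - clsSum (T K) (Bad K) (shB K) t b) (fun _ _ => {true})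
      (fun K _ _ => c₀ K + ν K) (fun K _ _ => vol * ((rr K + u K) + (s K + s₂ K))) (fun K _ _ => c₀ K)
      (fun K _ _ => vol * ((rr K + u K) + (s K + s₂ K))) ν 0 0 c₀ (fun K => (rr K + u K) + (s K + s₂ K)) 0 := by
  have hs := sandwich_of_reindexedBudget h
  refine
    { nonneg := fun K t ht b hb => ?_
      lower := fun K t ht b hb => ?_
      upper := fun K t ht b hb => ?_
      uv_const := fun K t ht b hb => hs.uv_const K t ht (Nat.zero_le K)
      uv_radius := fun K t ht b hb => hs.uv_radius K t ht (Nat.zero_le K)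
      recent_remainder := fun K t ht b hb => hs.recent_remainder K t ht (Nat.zero_le K)
      recent_deviation := fun K t ht b hb => hs.recent_deviation K t ht (Nat.zero_le K) }
  · obtain rfl := eq_false_of_mem_sdiff hb
    rw [clsSum_false_sub]
    exact Finset.sum_nonneg fun τ hτ => h.nonneg K t ht τ hτ
  · obtain rfl := eq_false_of_mem_sdiff hb
    rw [clsSum_false_sub, clsSum_false_sub]
    exact hs.lower K t ht (Nat.zero_le K)
  · obtain rfl := eq_false_of_mem_sdiff hb
    rw [clsSum_false_sub, clsSum_false_sub]
    exact hs.upper K t ht (Nat.zero_le K)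

end Budget

/-! ## §4 The collapse of a W7 witness -/

section Collapse

variable {F : T4Family} {G : Type} [GaugeGroup G] [MeasurableSpace G] [HaarData G] [RegularGaugeGroup G]
  {D : FiniteEpsData F G} {g₀ : ℕ → ℝ} {os : List (ULoop F)} {ι Λ : Type} [DecidableEq ι] {m₁ : ℕ}

/-- **THE COLLAPSE OF A W7 WITNESS TO TWO TERMS** (`hM : D.AvgMeasurable` for the integrability of the dressing): same cell
events, patterns, rates, radius, volume factor and threshold; terms `univ : Finset Bool`; events ∕ weights ∕ shells := the
class unions ∕ sums; NE7c summed (`shellWeightBound_cls`); NE7 aggregated (`reindexedBudget_cls`: constants `c₀ + ν`,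
rates `ν, 0, 0, c₀, (rr+u)+(s+s₂), 0`); sides by `collapseSide`. [folklore] -/
def _root_.Summit.QuantumFields.BalabanUV.T4Continuum.HistoryChessboardGibbs.ChessboardGibbsWitness.collapse
    (hM : D.AvgMeasurable) (X : ChessboardGibbsWitness D g₀ os ι Λ m₁) : ChessboardGibbsWitness D g₀ os Bool Λ m₁ where
  hm₁ := X.hm₁
  l₀ := X.l₀
  vol := X.vol
  l₀_pos := X.l₀_pos
  vol_pos := X.vol_pos
  K₀ := X.K₀
  P := X.P
  T _ := Finset.univ
  A K := clsSum (X.T K) (X.Bad K) (X.A K)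
  A' K := clsSum (X.T K) (X.Bad K) (X.A' K)
  shA K := clsSum (X.T K) (X.Bad K) (X.shA K)
  shB K := clsSum (X.T K) (X.Bad K) (X.shB K)
  Bad _ := {true}
  ev K := clsEv (X.T K) (X.Bad K) (X.ev K)
  E := X.E
  r := X.r
  ev' K := clsEv (X.T K) (X.Bad K) (X.ev' K)
  E' := X.E'
  r' := X.r'
  sideA K hK := collapseSide hM (X.sideA K hK)
  sideB K hK := collapseSide hM (X.sideB K hK)
  sum_r := X.sum_r
  sum_r' := X.sum_r'
  Cc K _ _ := X.c₀ K + X.ν K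
  Rr K _ _ := X.vol * ((X.rr K + X.u K) + (X.s K + X.s₂ K))
  CcRec K _ _ := X.c₀ K
  RrRec K _ _ := X.vol * ((X.rr K + X.u K) + (X.s K + X.s₂ K))
  ν := X.ν
  u := 0
  s₂ := 0
  c₀ := X.c₀
  rr K := (X.rr K + X.u K) + (X.s K + X.s₂ K)
  s := 0
  Wsh := X.Wsh
  shell := shellWeightBound_cls X.shell
  budget := reindexedBudget_cls X.budget
  sum_rr := (X.sum_rr.add X.sum_u).add (X.sum_s.add X.sum_s₂)
  sum_u := summable_zero
  sum_s := summable_zero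
  sum_s₂ := summable_zero

/-- The collapse keeps the threshold, the source radius and the volume factor (definitionally). [folklore] -/
example (hM : D.AvgMeasurable) (X : ChessboardGibbsWitness D g₀ os ι Λ m₁) :
    (X.collapse hM).K₀ = X.K₀ ∧ (X.collapse hM).l₀ = X.l₀ ∧ (X.collapse hM).vol = X.vol :=
  ⟨rfl, rfl, rfl⟩

end Collapse

/-! ## §5 The headline's witness hypothesis with arbitrary term types ⇔ with two terms -/

section Headline

variable {F : T4Family} {n : ℕ} [NeZero n] {ℰ : LoopAverage (Matrix.specialUnitaryGroup (Fin n) ℂ)}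

/-- **THE TERM LAYER OF THE W7 DISPLAY IS ELIMINABLE**: for (0.4)-block-averaged `SU(n)` data with a measurable
small-loop average, the prefixed witness hypothesis of W7's headline (`continuumYM4Torus_of_gibbsWitness_fsc`) with
ARBITRARY term types holds iff it holds with `ι := Bool` (two terms per cutoff). [folklore] -/
theorem forSmallCouplings_gibbsWitness_iff_bool (D : FiniteEpsData F (Matrix.specialUnitaryGroup (Fin n) ℂ))
    (hBA : D.IsBlockAveraged ℰ) (hE : ℰ.MeasurableE) :
    (T4ContinuumYM4Torus.ForSmallCouplings D fun g₀ => ∀ os : List (ULoop F),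
      ∃ (ι Λ : Type) (_ : DecidableEq ι) (m₁ : ℕ), Nonempty (ChessboardGibbsWitness D g₀ os ι Λ m₁)) ↔
    T4ContinuumYM4Torus.ForSmallCouplings D fun g₀ => ∀ os : List (ULoop F),
      ∃ (Λ : Type) (m₁ : ℕ), Nonempty (ChessboardGibbsWitness D g₀ os Bool Λ m₁) := by
  constructor
  · refine fun h => h.mono fun g₀ hg os => ?_
    obtain ⟨ι, Λ, _, m₁, ⟨X⟩⟩ := hg os
    exact ⟨Λ, m₁, ⟨X.collapse (hBA.avgMeasurable hE)⟩⟩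
  · refine fun h => h.mono fun g₀ hg os => ?_
    obtain ⟨Λ, m₁, ⟨X⟩⟩ := hg os
    exact ⟨Bool, Λ, inferInstance, m₁, ⟨X⟩⟩

/-- **THE W7 HEADLINE FROM TWO-TERM WITNESSES** (the `ι := Bool` form of `continuumYM4Torus_of_gibbsWitness_fsc`; by the
equivalence above nothing is lost). CONDITIONAL; NE7b NOT proved. [folklore] -/
theorem continuumYM4Torus_of_boolGibbsWitness_fsc (D : FiniteEpsData F (Matrix.specialUnitaryGroup (Fin n) ℂ))
    (hBA : D.IsBlockAveraged ℰ) (hE : ℰ.MeasurableE) (hB : B16.EndStatementBPrinted D.C) (hβ : BetaPertHyp D.βfun)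
    (hData : T4ContinuumYM4Torus.ForSmallCouplings D fun g₀ => ∀ os : List (ULoop F),
      ∃ (Λ : Type) (m₁ : ℕ), Nonempty (ChessboardGibbsWitness D g₀ os Bool Λ m₁)) :
    T4ContinuumYM4Torus.ContinuumYM4Torus D :=
  continuumYM4Torus_of_gibbsWitness_fsc D hBA hE hB hβ ((forSmallCouplings_gibbsWitness_iff_bool D hBA hE).2 hData)

end Headline

end

end Summit.QuantumFields.BalabanUV.T4Continuum.HistoryChessboardGibbsCollapse
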